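import Summits.MatrixMultiplication.OmegaCensus.SmallFormats.MatMul22nObstructionCombinatorics
import HarnessLib

/-!
# ω-census family (a): OBSTRUCTION COMBINATORICS II — complementarity of row pairs and column pairs (pure `Fin 4` counting)

Cell `pub-omega` (unit `pub-omega-tensor`, gen 40), topic `Summits/MatrixMultiplication/OmegaCensus` (sub-folder
`SmallFormats`). Framing (verbatim): lottery ticket; floor = certified bounds/negative ranges. HONEST FRAMING: M1-LEAN-BLUEPRINT step (a), CLAIM B (memo DEFLATION-g40
§3): with `(∃ j : Fin 4, j ≠ i ∧ f j = f i) :↔ ∃ j ≠ i, f j = f i` («`i` lies in a coincident pair of `f`»), a `(2,1,1)` map has exactly two such `i` (`card_hasP_eq_two`, decide); under the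
obstruction clause every cell `(v, μ)` with `μ` outside the pair of row `v` has `v` inside the pair of column `μ` (`col_of_not_row`), and COUNTING (8 = 8) upgrades this
to an equivalence (`ObstructionComp.row_iff_not_col`): `μ ∈ pair(v) ↔ v ∉ pair'(μ)` — the complementary structure of the 90 obstruction configurations. Nothing on `ω`.
-/

namespace Summit.MatrixMultiplication.OmegaCensus.SmallFormats

open Finset

namespace ObstructionComp

/-- If four naturals are each `≥ 2` and sum to `8`, each equals `2`. -/
theorem all_eq_two (g : Fin 4 → ℕ) (hge : ∀ m, 2 ≤ g m) (hsum : ∑ m, g m = 8) : ∀ m, g m = 2 := by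
  have h4 : ∑ m : Fin 4, g m = g 0 + g 1 + g 2 + g 3 := by simp [Fin.sum_univ_four]
  have h0 := hge 0; have h1 := hge 1; have h2 := hge 2; have h3 := hge 3
  intro m
  fin_cases m <;> simp <;> omega

set_option maxRecDepth 40000 in
set_option synthInstance.maxHeartbeats 400000 in
set_option synthInstance.maxSize 2048 in
/-- A `(2,1,1)` map (some coincidence, no triple, no two disjoint pairs) has exactly two paired points (decide). -/
theorem two_paired (f : Fin 4 → Fin 4) (hni : ∃ a b : Fin 4, a ≠ b ∧ f a = f b)
    (hnt : ∀ a b d : Fin 4, a ≠ b → a ≠ d → b ≠ d → ¬ (f a = f b ∧ f a = f d))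
    (h22 : ∀ a b c d : Fin 4, a ≠ b → a ≠ c → a ≠ d → b ≠ c → b ≠ d → c ≠ d → ¬ (f a = f b ∧ f c = f d)) :
    ∃ i₁ i₂ : Fin 4, i₁ ≠ i₂ ∧ (∃ j : Fin 4, j ≠ i₁ ∧ f j = f i₁) ∧ (∃ j : Fin 4, j ≠ i₂ ∧ f j = f i₂) ∧
      ∀ i : Fin 4, (∃ j : Fin 4, j ≠ i ∧ f j = f i) → i = i₁ ∨ i = i₂ := by
  revert f; decide

/-- Hence the set of paired points has exactly two elements. -/
theorem card_hasP_eq_two (f : Fin 4 → Fin 4) (hni : ∃ a b : Fin 4, a ≠ b ∧ f a = f b)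
    (hnt : ∀ a b d : Fin 4, a ≠ b → a ≠ d → b ≠ d → ¬ (f a = f b ∧ f a = f d))
    (h22 : ∀ a b c d : Fin 4, a ≠ b → a ≠ c → a ≠ d → b ≠ c → b ≠ d → c ≠ d → ¬ (f a = f b ∧ f c = f d)) :
    (Finset.univ.filter fun i => (∃ j : Fin 4, j ≠ i ∧ f j = f i)).card = 2 := by
  classical
  obtain ⟨i₁, i₂, hne, h₁, h₂, hall⟩ := two_paired f hni hnt h22
  have : (Finset.univ.filter fun i => (∃ j : Fin 4, j ≠ i ∧ f j = f i)) = {i₁, i₂} := by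
    ext i
    simp only [Finset.mem_filter, Finset.mem_univ, true_and, Finset.mem_insert, Finset.mem_singleton]
    constructor
    · exact hall i
    · rintro (rfl | rfl)
      · exact h₁
      · exact h₂
  rw [this, Finset.card_insert_of_notMem (by simpa using hne), Finset.card_singleton]

/-- From the obstruction clause: a cell outside the row pair lies inside the column pair. -/
theorem col_of_not_row (L L' : Fin 4 → Fin 4 → Fin 4) (hRni : ∀ v, ∃ a b : Fin 4, a ≠ b ∧ L v a = L v b)
    (hCni : ∀ μ, ∃ a b : Fin 4, a ≠ b ∧ L' μ a = L' μ b)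
    (hNF : ∀ v μ a bb a' bb', a ≠ bb → L v a = L v bb → μ ≠ a → μ ≠ bb → a' ≠ bb' → L' μ a' = L' μ bb' → L' μ v = L' μ a')
    (v μ : Fin 4) (h : ¬ (∃ j : Fin 4, j ≠ μ ∧ (L v) j = (L v) μ)) : (∃ j : Fin 4, j ≠ v ∧ (L' μ) j = (L' μ) v) := by
  obtain ⟨a, bb, hab, hL⟩ := hRni v
  obtain ⟨a', bb', hab', hL'⟩ := hCni μ
  have hμa : μ ≠ a := fun e => h ⟨bb, by rw [e]; exact hab.symm, by rw [e, hL]⟩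
  have hμb : μ ≠ bb := fun e => h ⟨a, by rw [e]; exact hab, by rw [e, hL]⟩
  have hv := hNF v μ a bb a' bb' hab hL hμa hμb hab' hL'
  by_cases hva : v = a'
  · exact ⟨bb', by rw [hva]; exact hab'.symm, by rw [hva, hL']⟩
  · exact ⟨a', Ne.symm hva, hv.symm⟩

/-- **Complementarity.** Under the clause, with all rows and columns `(2,1,1)`: `μ` is in the pair of row `v` iff `v` is NOT in the pair of column `μ`. -/
theorem row_iff_not_col (L L' : Fin 4 → Fin 4 → Fin 4) (hRni : ∀ v, ∃ a b : Fin 4, a ≠ b ∧ L v a = L v b)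
    (hCni : ∀ μ, ∃ a b : Fin 4, a ≠ b ∧ L' μ a = L' μ b)
    (hRnt : ∀ v a b d, a ≠ b → a ≠ d → b ≠ d → ¬ (L v a = L v b ∧ L v a = L v d))
    (hCnt : ∀ μ a b d, a ≠ b → a ≠ d → b ≠ d → ¬ (L' μ a = L' μ b ∧ L' μ a = L' μ d))
    (hR22 : ∀ v a b c d, a ≠ b → a ≠ c → a ≠ d → b ≠ c → b ≠ d → c ≠ d → ¬ (L v a = L v b ∧ L v c = L v d))
    (hC22 : ∀ μ a b c d, a ≠ b → a ≠ c → a ≠ d → b ≠ c → b ≠ d → c ≠ d → ¬ (L' μ a = L' μ b ∧ L' μ c = L' μ d))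
    (hNF : ∀ v μ a bb a' bb', a ≠ bb → L v a = L v bb → μ ≠ a → μ ≠ bb → a' ≠ bb' → L' μ a' = L' μ bb' → L' μ v = L' μ a')
    (v μ : Fin 4) : (∃ j : Fin 4, j ≠ μ ∧ (L v) j = (L v) μ) ↔ ¬ (∃ j : Fin 4, j ≠ v ∧ (L' μ) j = (L' μ) v) := by
  classical
  -- counts: 2 paired columns per row, 2 paired rows per column
  have hrow : ∀ w, (Finset.univ.filter fun m => (∃ j : Fin 4, j ≠ m ∧ (L w) j = (L w) m)).card = 2 := fun w => card_hasP_eq_two (L w) (hRni w) (hRnt w) (hR22 w)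
  have hcol : ∀ m, (Finset.univ.filter fun w => (∃ j : Fin 4, j ≠ w ∧ (L' m) j = (L' m) w)).card = 2 := fun m => card_hasP_eq_two (L' m) (hCni m) (hCnt m) (hC22 m)
  -- per column: the unpaired-in-row cells are ⊆ the paired-in-column cells, both of size ... ; count R-cells two ways
  have hsub : ∀ m, (Finset.univ.filter fun w => ¬ (∃ j : Fin 4, j ≠ m ∧ (L w) j = (L w) m)) ⊆ (Finset.univ.filter fun w => (∃ j : Fin 4, j ≠ w ∧ (L' m) j = (L' m) w)) := by
    intro m w hw
    rw [Finset.mem_filter] at hw ⊢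
    exact ⟨hw.1, col_of_not_row L L' hRni hCni hNF w m hw.2⟩
  have hcolR : ∀ m, 2 ≤ (Finset.univ.filter fun w => (∃ j : Fin 4, j ≠ m ∧ (L w) j = (L w) m)).card := by
    intro m
    have h1 := Finset.card_le_card (hsub m)
    have h2 := Finset.card_filter_add_card_filter_not (s := (Finset.univ : Finset (Fin 4))) (fun w => (∃ j : Fin 4, j ≠ m ∧ (L w) j = (L w) m))
    rw [Finset.card_univ, Fintype.card_fin, hcol m] at *
    omega
  -- double counting of R-cells: ∑_w 2 = 8 = ∑_m (#R-cells in column m) with each ≥ 2 ⇒ each = 2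
  have hdouble : ∑ m : Fin 4, (Finset.univ.filter fun w => (∃ j : Fin 4, j ≠ m ∧ (L w) j = (L w) m)).card = 8 := by
    have h := Finset.sum_comm (s := (Finset.univ : Finset (Fin 4))) (t := (Finset.univ : Finset (Fin 4)))
      (f := fun w m => if (∃ j : Fin 4, j ≠ m ∧ (L w) j = (L w) m) then (1 : ℕ) else 0)
    simp only [← Finset.card_filter] at h
    rw [← h]
    simp [hrow]
  have hcolR2 : ∀ m, (Finset.univ.filter fun w => (∃ j : Fin 4, j ≠ m ∧ (L w) j = (L w) m)).card = 2 :=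
    all_eq_two _ hcolR hdouble
  -- hence the complement of the R-cells in column μ has size 2 and equals the column pair set
  have heq : (Finset.univ.filter fun w => ¬ (∃ j : Fin 4, j ≠ μ ∧ (L w) j = (L w) μ)) = (Finset.univ.filter fun w => (∃ j : Fin 4, j ≠ w ∧ (L' μ) j = (L' μ) w)) := by
    apply Finset.eq_of_subset_of_card_le (hsub μ)
    have h2 := Finset.card_filter_add_card_filter_not (s := (Finset.univ : Finset (Fin 4))) (fun w => (∃ j : Fin 4, j ≠ μ ∧ (L w) j = (L w) μ))
    rw [Finset.card_univ, Fintype.card_fin, hcolR2 μ] at h2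
    rw [hcol μ]; omega
  constructor
  · intro hR hC
    have : v ∈ Finset.univ.filter fun w => ¬ (∃ j : Fin 4, j ≠ μ ∧ (L w) j = (L w) μ) := by rw [heq, Finset.mem_filter]; exact ⟨Finset.mem_univ _, hC⟩
    exact (Finset.mem_filter.mp this).2 hR
  · intro hC
    by_contra hR
    have : v ∈ Finset.univ.filter fun w => ¬ (∃ j : Fin 4, j ≠ μ ∧ (L w) j = (L w) μ) := Finset.mem_filter.mpr ⟨Finset.mem_univ _, hR⟩
    rw [heq, Finset.mem_filter] at this
    exact hC this.2

end ObstructionComp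

end Summit.MatrixMultiplication.OmegaCensus.SmallFormats
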